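import Summits.KontsevichZagierPeriods.KontsevichZagierPeriods.Theorems.HurwitzMicroSectorsNormalFormPrincipleM4SharedTools
import Literature.NumberTheory.Transcendental.KZDominatedFamilyRelations

/-!
# `NormalFormPrinciple` (stmt-KontsevichZagierPeriods-3869), line `SketchIdeator1` —
# leaf `stub_boxRigidity`, layer `Island`: the symmetric box `P` is two triangles

The PRODUCT ISLAND at height `q` (`q : ℕ`, `2 ≤ q`) is a dimension-two layer of the leaf
`stub_boxRigidity`: atoms on the open square `□² = {x | ∀ i, x i ∈ Ioo 0 1}` with denominators
`(q − x₀)`, `(q − x₁)`, `(q − x₀x₁)`. This file is step (iii) of the chain `2q·V ∼ 2D + P`: the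
box `P = [□², 1/((q − x₀)(q − x₁))]`, whose integrand is SYMMETRIC under `x₀ ↔ x₁`, dissects into
the triangle `Tr = [Δ₂ = {0 < t₁ < t₀ < 1}, 1/((q − t₀)(q − t₁))]` and its mirror image
`Tr' = {0 < t₀ < t₁ < 1}` (rule (1a) of the Kontsevich–Zagier calculus: the complement of
`Δ₂ ∪ Δ₂'` in `□²` is the Lebesgue-null diagonal `{x₀ = x₁}`, split off by
`KZ.IntegralRep.of_sub_of_restrict_mem_relations`, then one domain-additivity move along the two
disjoint triangles), and `Tr'` is the coordinate swap of `Tr` — the reindexed representation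
`Tr.reindex (Equiv.swap 0 1)`, one change of variables (rule (2), a coordinate permutation,
`|det| = 1`: `KZ.of_sub_of_reindex_mem_relations`) away from `Tr`, with the same integrand by
symmetry. Hence `[P] − 2·[Tr] ∈ KZ.relations`. The mechanism is stated once for an arbitrary
swap-symmetric integrand on the box (`islP_box_sub_two_nsmul_mem_relations`); the hypothesis
`2 ≤ q` is not used (the carriers are given).
References: M. Kontsevich, D. Zagier, *Periods* (2001), §1.1–1.2, rules (1), (2). No definitions
are introduced.
-/

noncomputable section

open MeasureTheory Set
open Literature.NumberTheory.Transcendental Literature.NumberTheory.Transcendental.KZ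
open Literature.ModelTheory.ExponentialFields (IsSemialgebraic)

namespace Summit.KontsevichZagierPeriods.HurwitzMicroSectors.NormalFormPrinciple.PiBox.Island

/-- **A swap-symmetric box is twice the triangle.** Let `P` be a representation over the open
square `□²` whose integrand is invariant under the coordinate swap `x₀ ↔ x₁` on the square, and
`Tr` a representation over the triangle `Δ₂ = {0 < t₁ < t₀ < 1}` whose integrand agrees with that
of `P` there. Then `[P] − 2·[Tr] ∈ KZ.relations`: split off the null diagonal `{x₀ = x₁}`
(rule (1a) with a null piece), cut the rest along the two disjoint open triangles `Δ₂` and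
`Δ₂' = {0 < t₀ < t₁ < 1}` (rule (1a)); over `Δ₂'` the integrand of `P` is that of the reindexed
representation `Tr.reindex (Equiv.swap 0 1)` (by symmetry), which is one coordinate-permutation
move away from `Tr` (rule (2)). [cite: KontsevichZagier2001, §1.2 rules (1), (2)] -/
theorem islP_box_sub_two_nsmul_mem_relations (P Tr : IntegralRep 2)
    (hPd : P.domain = {x | ∀ i, x i ∈ Set.Ioo (0:ℝ) 1})
    (hTd : Tr.domain = {t | 0 < t 1 ∧ t 1 < t 0 ∧ t 0 < 1})
    (hsymm : ∀ x ∈ P.domain, P.integrand (fun i => x (Equiv.swap (0 : Fin 2) 1 i)) = P.integrand x)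
    (hagree : EqOn P.integrand Tr.integrand Tr.domain) :
    of P - (2:ℕ) • of Tr ∈ relations := by
  -- the mirror triangle `Δ₂'`, domain of the reindexed representation
  have hT'd : (Tr.reindex (Equiv.swap (0 : Fin 2) 1)).domain =
      {t | 0 < t 0 ∧ t 0 < t 1 ∧ t 1 < 1} := by
    rw [IntegralRep.reindex_domain, hTd]
    ext t
    simp only [mem_setOf_eq, Equiv.swap_apply_left, Equiv.swap_apply_right]
  have hEσ : IsSemialgebraic ℚ (Tr.domain ∪ (Tr.reindex (Equiv.swap (0 : Fin 2) 1)).domain) :=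
    Tr.isSemialgebraic_domain.union (Tr.reindex (Equiv.swap (0 : Fin 2) 1)).isSemialgebraic_domain
  -- both triangles lie in the box
  have hTsub : Tr.domain ⊆ P.domain := by
    intro t ht
    rw [hTd] at ht
    obtain ⟨h1, h10, h0⟩ := ht
    rw [hPd]
    simp only [mem_setOf_eq, Fin.forall_fin_two, mem_Ioo]
    exact ⟨⟨h1.trans h10, h0⟩, h1, h10.trans h0⟩
  have hT'sub : (Tr.reindex (Equiv.swap (0 : Fin 2) 1)).domain ⊆ P.domain := by
    intro t ht
    rw [hT'd] at ht
    obtain ⟨h0, h01, h1⟩ := ht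
    rw [hPd]
    simp only [mem_setOf_eq, Fin.forall_fin_two, mem_Ioo]
    exact ⟨⟨h0, h01.trans h1⟩, h0.trans h01, h1⟩
  have hEsub : Tr.domain ∪ (Tr.reindex (Equiv.swap (0 : Fin 2) 1)).domain ⊆ P.domain :=
    union_subset hTsub hT'sub
  -- the diagonal `{x₀ = x₁}` is a proper linear subspace, hence Lebesgue-null
  have hdiag : volume {y : Fin 2 → ℝ | y 0 = y 1} = 0 := by
    let L : (Fin 2 → ℝ) →ₗ[ℝ] ℝ :=
      LinearMap.proj (R := ℝ) (φ := fun _ : Fin 2 => ℝ) 0 -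
        LinearMap.proj (R := ℝ) (φ := fun _ : Fin 2 => ℝ) 1
    have hL : ∀ y, L y = y 0 - y 1 := fun y => rfl
    have hset : {y : Fin 2 → ℝ | y 0 = y 1} = (LinearMap.ker L : Set (Fin 2 → ℝ)) := by
      ext y
      simp [hL, sub_eq_zero]
    have h10 : (1 : Fin 2) ≠ 0 := by decide
    rw [hset]
    refine Measure.addHaar_submodule volume (LinearMap.ker L) fun htop => ?_
    have hmem : (Pi.single 0 1 : Fin 2 → ℝ) ∈ LinearMap.ker L := htop ▸ Submodule.mem_top
    rw [LinearMap.mem_ker, hL, Pi.single_eq_same, Pi.single_eq_of_ne h10, sub_zero] at hmem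
    exact one_ne_zero hmem
  -- the complement of the two triangles in the box is contained in the diagonal
  have hvol : volume (P.domain \ (Tr.domain ∪ (Tr.reindex (Equiv.swap (0 : Fin 2) 1)).domain)) =
      0 := by
    refine measure_mono_null (fun t ht => ?_) hdiag
    obtain ⟨htP, htE⟩ := ht
    rw [hPd] at htP
    simp only [mem_setOf_eq, Fin.forall_fin_two, mem_Ioo] at htP
    rw [mem_union, not_or, hTd, hT'd] at htE
    obtain ⟨hA, hB⟩ := htE
    rcases lt_trichotomy (t 0) (t 1) with hlt | heq | hgt
    · exact (hB ⟨htP.1.1, hlt, htP.2.2⟩).elim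
    · exact heq
    · exact (hA ⟨htP.2.1, hgt, htP.1.2⟩).elim
  -- move 1 (rule 1a with a null piece): split off the diagonal
  have e0 : of P - of (P.restrict _ hEσ hEsub) ∈ relations :=
    P.of_sub_of_restrict_mem_relations hEσ hEsub hvol
  -- move 2 (rule 1a): the two triangles are disjoint
  have hdisj : Tr.domain ∩ (Tr.reindex (Equiv.swap (0 : Fin 2) 1)).domain = ∅ := by
    rw [hTd, hT'd]
    ext t
    simp only [mem_inter_iff, mem_setOf_eq, mem_empty_iff_false, iff_false]
    rintro ⟨⟨_, h10, _⟩, _, h01, _⟩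
    exact lt_asymm h10 h01
  have e1 : of (P.restrict _ hEσ hEsub) - of Tr - of (Tr.reindex (Equiv.swap (0 : Fin 2) 1)) ∈
      relations :=
    domainAddRel_subset_relations ⟨2, P.restrict _ hEσ hEsub, Tr,
      Tr.reindex (Equiv.swap (0 : Fin 2) 1), rfl, by rw [hdisj, measure_empty],
      fun t ht => hagree ht, fun t ht => by
        have ht' : (fun i => t (Equiv.swap (0 : Fin 2) 1 i)) ∈ Tr.domain := ht
        show P.integrand t = Tr.integrand (fun i => t (Equiv.swap (0 : Fin 2) 1 i))
        rw [← hagree ht', hsymm t (hT'sub ht)], rfl⟩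
  -- move 3 (rule 2): the coordinate swap
  have e2 : of Tr - of (Tr.reindex (Equiv.swap (0 : Fin 2) 1)) ∈ relations :=
    of_sub_of_reindex_mem_relations Tr _
  have e : of P - (2:ℕ) • of Tr = (of P - of (P.restrict _ hEσ hEsub)) +
      (of (P.restrict _ hEσ hEsub) - of Tr - of (Tr.reindex (Equiv.swap (0 : Fin 2) 1))) -
      (of Tr - of (Tr.reindex (Equiv.swap (0 : Fin 2) 1))) := by
    rw [two_nsmul]
    abel
  rw [e]
  exact relations.sub_mem (relations.add_mem e0 e1) e2

/-- **Step (iii) of the island chain `2q·V ∼ 2D + P`: the box `P` is two triangles.** For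
carriers `P = [□², 1/((q − x₀)(q − x₁))]` and `Tr = [Δ₂, 1/((q − t₀)(q − t₁))]` (integrands
pinned on their domains only), `[P] − 2·[Tr] ∈ KZ.relations`: the integrand of `P` is symmetric
under `x₀ ↔ x₁` (commutativity of the product), so the box dissects (rule (1a), the diagonal being
null) into `Δ₂` and its mirror image, the latter being the coordinate swap of `Tr` (rule (2)).
The hypothesis `2 ≤ q` is not used. [cite: KontsevichZagier2001, §1.2 rules (1), (2)] -/
theorem isl_dissect_P :
    ∀ (q : ℕ), 2 ≤ q → ∀ (P Tr : IntegralRep 2),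
      P.domain = {x | ∀ i, x i ∈ Set.Ioo (0:ℝ) 1} →
      EqOn P.integrand (fun x => 1 / (((q:ℝ) - x 0) * ((q:ℝ) - x 1))) P.domain →
      Tr.domain = {t | 0 < t 1 ∧ t 1 < t 0 ∧ t 0 < 1} →
      EqOn Tr.integrand (fun t => 1 / (((q:ℝ) - t 0) * ((q:ℝ) - t 1))) Tr.domain →
      of P - (2:ℕ) • of Tr ∈ relations := by
  intro q _hq P Tr hPd hPi hTd hTi
  refine islP_box_sub_two_nsmul_mem_relations P Tr hPd hTd (fun x hx => ?_) fun t ht => ?_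
  · -- symmetry of `1/((q − x₀)(q − x₁))` under the swap (the box is swap-invariant)
    have hx' : (fun i => x (Equiv.swap (0 : Fin 2) 1 i)) ∈ P.domain := by
      rw [hPd] at hx ⊢
      exact fun i => hx _
    rw [hPi hx, hPi hx']
    simp only [Equiv.swap_apply_left, Equiv.swap_apply_right]
    ring
  · -- the two pinned integrands agree on the triangle
    have htP : t ∈ P.domain := by
      rw [hTd] at ht
      obtain ⟨h1, h10, h0⟩ := ht
      rw [hPd]
      simp only [mem_setOf_eq, Fin.forall_fin_two, mem_Ioo]
      exact ⟨⟨h1.trans h10, h0⟩, h1, h10.trans h0⟩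
    rw [hPi htP, hTi ht]

end Summit.KontsevichZagierPeriods.HurwitzMicroSectors.NormalFormPrinciple.PiBox.Island
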